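import Literature.Topology.FourManifolds.GompfSectionCircleFramings
import HarnessLib

/-!
# Towards `akbulutKirby1979_sphere_four_holds`: the framing-agnostic entrance and the exact
# remaining obligation on the tree's concrete objects

Sibling proof file (theorems only; D-0014, D-0026: no new named fact) of
`Literature/Topology/FourManifolds/CappellShanesonGompfReduction.lean`, for its named fact
`Literature.Topology.FourManifolds.akbulutKirby1979_sphere_four` — the framing-free form of
S. Akbulut, R. Kirby, *An exotic involution of `S⁴`*, Topology 18 (1979) 75–81, Theorem (p. 75:
the homotopy sphere `Σ⁴ = Ĉ ∪ S² × B²` built from the monodromy `A²`, conjugate to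
`A₀ = akbulutKirbyMatrix`, with the untwisted framing, is diffeomorphic to `S⁴`): *some*
Cappell–Shaneson sphere of `A₀` is diffeomorphic to `S⁴`. This is the file in which the discharge
`akbulutKirby1979_sphere_four_holds` is to be placed (the fact's own docstring: "to be placed in a
sibling file importing `GompfFramedSpheres.lean` (not here: import cycle)").

## What is proved here

The designated discharge path of the tree is
`akbulutKirby1979_sphere_four_of_framed : akbulutKirby1979_linearStraightening → …`
(`GompfFramedSpheres.lean`), through [AK1] *for the linear straightening* `σ_lin` of `A₀`, i.e. for
one *named* framing. The `∃`-form does not need the framing to be named, and the identification of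
the tree's tube `sectionCircleNbhd A₀ akbulutKirbyLinearPath` with the printed "untwisted framing"
depends on orientation conventions (see the docstring of `akbulutKirby1979_linearStraightening`:
"Should the orientation conventions nevertheless exchange the two straightening classes, the
displayed manifold is the *twisted* `A₀`-sphere"). This file records, sorry-free, the
**framing-agnostic** entrances and shows that they are *exactly* equivalent to the fact:

* `akbulutKirby1979_sphere_four_of_gompfSphere γ`: if Gompf's concrete sphere
  `X^{[γ]}_{A₀} = gompfSphere akbulutKirbyMatrix γ` is diffeomorphic to `S⁴` for **any one** smooth
  framing path `γ` from `1` to `A₀` (either straightening class), the fact holds — whichever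
  framing a Kirby-calculus proof ([AK1]; Aitchison–Rubinstein, Contemp. Math. 35 (1984), Thm 4.3
  at `v = 0`; Akbulut, Ann. of Math. 171 (2010)) trivialises;
* `akbulutKirby1979_sphere_four_iff_exists_gompfSphere`: conversely, by the **proved**
  classification of Cappell–Shaneson spheres by straightenings
  (`gompf2010_straightening_classification_holds`, `GompfSectionCircleFramings.lean`), the fact is
  *equivalent* to `∃ γ, gompfSphere A₀ γ ≅ S⁴`;
* `akbulutKirby1979_sphere_four_iff_exists_isCircleSurgery_csTorus`: equivalently again, `S⁴`
  itself is obtained from the tree's concrete mapping torus `CSTorus A₀` by circle surgery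
  (`IsCircleSurgery`, any tube, either framing) on a smoothly embedded circle whose image is the
  standard section `inl ({1} × (0, 1)) ∪ inr ({1} × (1/2, 3/2))` — the sharpest restatement on the
  tree's objects of what remains to be constructed: a tubular neighbourhood `ν` of the section
  circle of `CSTorus A₀` and two open smooth embeddings `CSTorus A₀ ∖ C ↪ S⁴`, `D̊² × S² ↪ S⁴`
  covering `S⁴` and overlapping exactly along `circleSurgeryRel ν` (Akbulut–Kirby 1979, p. 75,
  "`Σ⁴ = Ĉ ∪ S² × B²` … is diffeomorphic to `S⁴`"; Gompf, Algebr. Geom. Topol. 10 (2010), §1).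

Every printed proof of the remaining statement is a handle computation ([AK1] pp. 76–81;
Aitchison–Rubinstein 1984, §4, Thm 4.3: `Σ₀ = M_B ∪ M_D` with `M_B ≅ M_D ≅ B⁴` by handle slides,
then "two balls in dimension four are glued together in an essentially unique way", i.e. Cerf's
`Γ₄ = 0`, the tree's named fact `cerf_twistedSphere_four`), so the fact stays parked on the
Kirby-calculus leaf `akbulutKirby1979_linearStraightening` (or, for the other class, on the same
computation for that class); nothing here changes a statement or introduces a fact.

## References

* S. Akbulut, R. Kirby, *An exotic involution of `S⁴`*, Topology 18 (1979) 75–81,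
  doi:10.1016/0040-9383(79)90015-6, Theorem p. 75 and pp. 76–81. [AkbulutKirby1979]
* R. E. Gompf, *More Cappell–Shaneson spheres are standard*, Algebr. Geom. Topol. 10 (2010)
  1665–1681, §1, §4 ¶2 (the manifolds `X^σ`), Examples 3.1(a). [GompfAGT2010]
* I. R. Aitchison, J. H. Rubinstein, *Fibered knots and involutions on homotopy spheres*, in
  *Four-Manifold Theory* (Gordon, Kirby eds.), Contemp. Math. 35 (1984) 1–74, §4, Thm 4.3.
-/

open scoped Manifold ContDiff Topology
open Set

noncomputable section

namespace Literature.Topology.FourManifolds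

-- No local notation (kernel-only review lane); the spheres are spelled out as in the statements
-- they serve: `S⁴ = Metric.sphere (0 : EuclideanSpace ℝ (Fin (4 + 1))) 1`, `S¹` likewise.

/-! ### The framing-agnostic entrance through Gompf's concrete spheres -/

/-- **[AK1], framing-agnostic entrance.** If Gompf's concrete Cappell–Shaneson sphere
`X^{[γ]}_{A₀} = gompfSphere akbulutKirbyMatrix γ` is diffeomorphic to `S⁴` for *some* smooth framing
path `γ` from `1` to `A₀` — either straightening class — then `akbulutKirby1979_sphere_four` holds:
`gompfSphere A₀ γ` is a closed smooth 4-manifold in `Type` and a Cappell–Shaneson sphere of `A₀`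
(`isCappellShanesonSphereOf_gompfSphere_akbulutKirby`, Gompf 2010, §4 ¶2). The case
`γ = akbulutKirbyLinearPath` is `akbulutKirby1979_sphere_four_of_framed`.
[cite: AkbulutKirby1979, p. 75 (Theorem: Σ⁴ ≅ S⁴)]
[cite: GompfAGT2010, §4 (the manifolds X^σ, after Def. 4.1)] -/
theorem akbulutKirby1979_sphere_four_of_gompfSphere
    (γ : SmoothMatrixPath (slRealMatrix akbulutKirbyMatrix))
    (h : Nonempty (gompfSphere akbulutKirbyMatrix γ ≃ₘ⟮𝓡 4, 𝓡 4⟯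
      ↥(Metric.sphere (0 : EuclideanSpace ℝ (Fin (4 + 1))) 1))) :
    akbulutKirby1979_sphere_four :=
  ⟨gompfSphere akbulutKirbyMatrix γ, inferInstance, inferInstance, inferInstance, inferInstance,
    inferInstance, inferInstance, isCappellShanesonSphereOf_gompfSphere_akbulutKirby γ, h⟩

/-- **Conversely, the fact returns a concrete standard sphere**: if some Cappell–Shaneson sphere
`X` of `A₀` is `S⁴`, then `X ≅ gompfSphere A₀ γ` for some framing path `γ` by the proved
classification of Cappell–Shaneson spheres by straightenings
(`gompf2010_straightening_classification_holds`, Gompf 2010, §4 ¶2: "the two straightenings …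
canonically determine … the two resulting diffeomorphism types `X^σ`"), whence
`gompfSphere A₀ γ ≅ S⁴`.
[cite: GompfAGT2010, §4 ¶2 (X^σ well defined; framings ↔ straightenings)] -/
theorem exists_nonempty_diffeomorph_gompfSphere_sphere_of_akbulutKirby1979_sphere_four
    (h : akbulutKirby1979_sphere_four) :
    ∃ γ : SmoothMatrixPath (slRealMatrix akbulutKirbyMatrix),
      Nonempty (gompfSphere akbulutKirbyMatrix γ ≃ₘ⟮𝓡 4, 𝓡 4⟯
        ↥(Metric.sphere (0 : EuclideanSpace ℝ (Fin (4 + 1))) 1)) := by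
  obtain ⟨X, _, _, _, _, _, _, hX, ⟨e⟩⟩ := h
  obtain ⟨γ, ⟨f⟩⟩ := gompf2010_straightening_classification_holds.{0} akbulutKirbyMatrix X hX
  exact ⟨γ, ⟨f.symm.trans e⟩⟩

/-- **`akbulutKirby1979_sphere_four` is exactly "[AK1] for some framing path"**: some
Cappell–Shaneson sphere of `A₀` is `S⁴` iff some concrete `X^{[γ]}_{A₀} = gompfSphere A₀ γ` is `S⁴`
(`→`: the proved classification by straightenings; `←`: the concrete spheres are Cappell–Shaneson
spheres of `A₀`). Compare `akbulutKirby1979_linearStraightening`, which names the path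
`γ = akbulutKirbyLinearPath`; under Theorem 4.3 (`gompf2010_thm43`) the two are equivalent, without
it the `∃`-form is the weaker, convention-independent statement.
[cite: AkbulutKirby1979, p. 75 (Theorem: Σ⁴ ≅ S⁴)]
[cite: GompfAGT2010, §4 ¶2 (X^σ well defined; framings ↔ straightenings)] -/
theorem akbulutKirby1979_sphere_four_iff_exists_gompfSphere :
    akbulutKirby1979_sphere_four ↔
      ∃ γ : SmoothMatrixPath (slRealMatrix akbulutKirbyMatrix),
        Nonempty (gompfSphere akbulutKirbyMatrix γ ≃ₘ⟮𝓡 4, 𝓡 4⟯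
          ↥(Metric.sphere (0 : EuclideanSpace ℝ (Fin (4 + 1))) 1)) :=
  ⟨exists_nonempty_diffeomorph_gompfSphere_sphere_of_akbulutKirby1979_sphere_four,
    fun ⟨γ, h⟩ => akbulutKirby1979_sphere_four_of_gompfSphere γ h⟩

/-! ### The remaining obligation on the concrete mapping torus `CSTorus A₀` -/

/-- **`S⁴` as a circle surgery on the concrete Cappell–Shaneson mapping torus gives the fact.** If
`S⁴` is obtained from `CSTorus A₀ = T³ × ℝ / (x, s) ∼ (A₀ x, s + 1)` by surgery
(`IsCircleSurgery`: some tube `ν`, either framing, and an open gluing of `CSTorus A₀ ∖ C` with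
`D̊² × S²` onto `S⁴` along `circleSurgeryRel ν`) on a smoothly embedded circle `c` whose image is
the standard section `inl ({1} × (0, 1)) ∪ inr ({1} × (1/2, 3/2))`, then `S⁴` is a Cappell–Shaneson
sphere of `A₀` with the canonical witnesses (`csGlueData A₀`, `isOpenGluingWith_mappingTorusGlued`),
hence `akbulutKirby1979_sphere_four` (`akbulutKirby1979_sphere_four_iff`). This is the form in which
[AK1] states it: "`Σ⁴ = Ĉ ∪ S² × B²` … is diffeomorphic to `S⁴`", `Ĉ` the mapping torus on
`T³ ∖ V`. [cite: AkbulutKirby1979, p. 75 (Theorem: Σ⁴ ≅ S⁴)] -/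
theorem akbulutKirby1979_sphere_four_of_isCircleSurgery_csTorus
    (c : ↥(Metric.sphere (0 : EuclideanSpace ℝ (Fin (1 + 1))) 1) → CSTorus akbulutKirbyMatrix)
    (hc : Manifold.IsSmoothEmbedding (𝓡 1) (𝓡 4) ∞ c)
    (hr : range c = (csGlueData akbulutKirbyMatrix).inl '' ({1} ×ˢ univ) ∪
      (csGlueData akbulutKirbyMatrix).inr '' ({1} ×ˢ univ))
    (hs : IsCircleSurgery (𝓡 4) (𝓡 4) (CSTorus akbulutKirbyMatrix)
      ↥(Metric.sphere (0 : EuclideanSpace ℝ (Fin (4 + 1))) 1) c) :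
    akbulutKirby1979_sphere_four :=
  akbulutKirby1979_sphere_four_iff.2
    ⟨Or.inl det_akbulutKirbyMatrix_sub_one, CSTorus akbulutKirbyMatrix, inferInstance,
      inferInstance, inferInstance, inferInstance, inferInstance, inferInstance,
      (csGlueData akbulutKirbyMatrix).inl, (csGlueData akbulutKirbyMatrix).inr,
      isOpenGluingWith_mappingTorusGlued _ _, c, hc, hr, hs⟩

/-- **`akbulutKirby1979_sphere_four` is exactly "`S⁴` is a circle surgery on `CSTorus A₀` along
its section circle"** (`→`: `S⁴` is a Cappell–Shaneson sphere of `A₀`,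
`akbulutKirby1979_sphere_four_iff`, and every such sphere is a surgery on the concrete mapping
torus along some parametrisation and some tube of the standard section circle,
`IsCappellShanesonSphereOf.exists_isCircleSurgery_csTorus` — uniqueness of open gluings with
witnesses and transport of circle surgery along the resulting diffeomorphism; `←`: the previous
theorem). This pins the remaining obligation of the fact to the construction, on the tree's
concrete objects, of a tube of the section circle of `CSTorus A₀` and of the two surgery
embeddings into the standard `S⁴` — the content of the handle computation of [AK1], pp. 76–81.
[cite: AkbulutKirby1979, p. 75 (Theorem: Σ⁴ ≅ S⁴)]
[cite: GompfAGT2010, §4 ¶2 (X^σ well defined; framings ↔ straightenings)] -/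
theorem akbulutKirby1979_sphere_four_iff_exists_isCircleSurgery_csTorus :
    akbulutKirby1979_sphere_four ↔
      ∃ c : ↥(Metric.sphere (0 : EuclideanSpace ℝ (Fin (1 + 1))) 1) → CSTorus akbulutKirbyMatrix,
        Manifold.IsSmoothEmbedding (𝓡 1) (𝓡 4) ∞ c ∧
        range c = (csGlueData akbulutKirbyMatrix).inl '' ({1} ×ˢ univ) ∪
          (csGlueData akbulutKirbyMatrix).inr '' ({1} ×ˢ univ) ∧
        IsCircleSurgery (𝓡 4) (𝓡 4) (CSTorus akbulutKirbyMatrix)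
          ↥(Metric.sphere (0 : EuclideanSpace ℝ (Fin (4 + 1))) 1) c := by
  refine ⟨fun h => ?_, fun ⟨c, hc, hr, hs⟩ =>
    akbulutKirby1979_sphere_four_of_isCircleSurgery_csTorus c hc hr hs⟩
  exact (akbulutKirby1979_sphere_four_iff.1 h).exists_isCircleSurgery_csTorus

/-- In particular the surgery may be taken along the tree's own section circle `sectionCircle A₀ γ`
(any framing path `γ`; its range is the standard section, `range_sectionCircle`): the fact holds as
soon as `S⁴` is *some* circle surgery — any tube, either framing — on `CSTorus A₀` along
`sectionCircle A₀ γ`. [cite: AkbulutKirby1979, p. 75 (Theorem: Σ⁴ ≅ S⁴)] -/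
theorem akbulutKirby1979_sphere_four_of_isCircleSurgery_sectionCircle
    (γ : SmoothMatrixPath (slRealMatrix akbulutKirbyMatrix))
    (hs : IsCircleSurgery (𝓡 4) (𝓡 4) (CSTorus akbulutKirbyMatrix)
      ↥(Metric.sphere (0 : EuclideanSpace ℝ (Fin (4 + 1))) 1)
      (sectionCircle akbulutKirbyMatrix γ)) :
    akbulutKirby1979_sphere_four :=
  akbulutKirby1979_sphere_four_of_isCircleSurgery_csTorus _
    (isSmoothEmbedding_sectionCircle akbulutKirbyMatrix γ)
    (range_sectionCircle akbulutKirbyMatrix γ) hs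

end Literature.Topology.FourManifolds
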